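import Literature.Computability.Complexity.GoldwasserSipserGame
import Literature.Computability.Complexity.ArthurMerlinBoards
import Literature.Computability.Complexity.IterateFPPoly
import Literature.Computability.Complexity.ListFoldChecks
import Literature.Computability.Complexity.SplitOnesBricks
import Literature.Computability.Complexity.StackUnary
import Literature.Computability.Complexity.StockmeyerMachines
import HarnessLib

/-!
# The Goldwasser–Sipser referee, I: bricks (hash check, transcript replay, the round checks)

Machine half of the PROOF of the Goldwasser–Sipser theorem (`IP[k] ⊆ AM[k+2]`, the named fact
`Literature.Computability.Complexity.GoldwasserSipser1986_IPk_subset_AMk`): the referee of the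
public-coin simulation game `GoldwasserSipser.Accepts` (`GoldwasserSipserGame.lean`) "acts in
polynomial time, using the old verifier as a subroutine". This file writes its string functions in
the tree's algebra of `FP` bricks (`BrickAlgebra.lean`, `PlumbingBricks.lean`, `FoldBricks.lean`,
`HashBricks.lean`) — no Turing machine is programmed — and proves their values on records:

* `Brick.foldLoop_mem_FP_of_poly` — the counted fold `acc := op ⟨acc, f ⟨x, 1ⁱ⟩⟩` with pieces of
  POLYNOMIAL size in the context (`Brick.loopFn_mem_FP_of_poly`), so that folds whose pieces are
  messages of the simulated verifier (length `msgLen(|x|)`) need no clipping;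
* `GSRef.hashFailsFn` / **`GSRef.hashOkFn`** — the bit-level test
  `Stockmeyer.HashesToZero u d b v` of the public-coin hash (`StockmeyerEstimator.lean`: row `j`
  of `u` is `d` matrix bits and an offset bit from coin `j (d+1)`; the row parity is the `𝔽₂`
  inner product `HashBricks.andParityFn` xor the offset bit) as a one-bit `FP` function of
  `⟨u, ⟨1^d, ⟨1^b, v⟩⟩⟩`, by a fold over the `b` rows (`hashOkFn_apply`);
* `GSRef.bktU` — the bucket `1^{bktOf w}` announced in a Merlin move (`SplitOnesBricks.onesPrefixFn`
  on the `ℓ + 1` bits after the two messages; `splitOnes_fst_eq_leadOnes`);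
* **`GSRef.replayFn`** — replaying the simulated verifier `W` on Merlin's coins `r` against the
  prover answers recorded in a transcript code `E = encList τ`: a fold whose operation appends
  `W`'s next message (from the view `⟨x, ⟨r, ⟨1^{|P|}, encList P⟩⟩⟩`, truncated/padded to
  `msgLen` by `take m (· ++ 0^m)`) and the recorded answer; `replayFn_apply`. Consistency of `r`
  with `τ` (`PCGame.Consistent`) is then the string equality "replay = `E`" (next file);
* the round record `⟨x, ⟨1^κ, ⟨1^j, ⟨encList τ, ⟨1^i, rest⟩⟩⟩⟩⟩` of the referee, the round step
  `GSRef.stepF`, the hash-length arithmetic `GSRef.bLenU` (`((κ ∸ (j+1+β)) ∸ γ)` by `drop` on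
  unary strings), the round test `GSRef.roundOkF`, the final test `GSRef.finalOkF` (hash of the
  coins, replay = transcript, `W` accepts), the recursion `GSRef.chkF R` and the referee language
  `GSRef.gsRef W R kf γ Mv` with **`gsRef_mem_P`**. Its agreement with
  `GoldwasserSipser.Accepts` is `GoldwasserSipserReferee.lean`.

## References

* S. Arora, B. Barak, *Computational Complexity: A Modern Approach*, CUP 2009, §8.2.2–8.2.3
  (the set lower bound protocol and the sketch of Thm. 8.12), §1.3 (polynomial time is closed
  under composition and bounded loops).
* L. Babai, S. Moran, *Arthur–Merlin games …*, JCSS 36 (1988), §2.5 ("the new referee acts in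
  polynomial time").
-/

noncomputable section

namespace Literature.Computability.Complexity

open _root_.Computability Polynomial Brick Plumb OracleCompose HashBricks Kannan Stockmeyer

/-! ### Folds with pieces of polynomial size -/

namespace Brick

/-- **Growth of the fold body, polynomial form**: for `op` of growth
`|op ⟨a, b⟩| ≤ |a| + G₁(|b|)` and `f` of growth `|f w| ≤ G₂(|fstF w|)` (both on every input), the
body of `foldLoop op f` satisfies the hypothesis of `loopFn_mem_FP_of_poly` with the polynomial
`G₁ ∘ G₂ + 4`. [folklore] -/
theorem length_foldBody_le_poly {op f : List Bool → List Bool} {G₁ G₂ : Polynomial ℕ}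
    (hop : ∀ w, (op w).length ≤ (fstF w).length + G₁.eval (sndF w).length)
    (hf : ∀ w, (f w).length ≤ G₂.eval (fstF w).length) (z : List Bool) :
    (foldBody op f z).length ≤ (sndPow 1 z).length + (G₁.comp G₂ + 4).eval (fstF z).length := by
  rw [foldBody, length_fanoutFn]
  have h1 : 2 * (nthF 2 z).length + (sndPow 2 z).length ≤ (sndPow 1 z).length :=
    length_nthF_succ_add_sndPow_succ_le 1 z
  have h2 := hop (fanoutFn (sndPow 2) (f ∘ fanoutFn (nthF 0) (nthF 2)) z)
  have h3 := hf (fanoutFn (nthF 0) (nthF 2) z)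
  simp only [Function.comp_apply, fanoutFn_apply, fstF_boolPair, sndF_boolPair, List.length_cons,
    nthF_zero] at h2 h3 ⊢
  have h4 : G₁.eval (f (boolPair (fstF z) (nthF 2 z))).length ≤ G₁.eval (G₂.eval (fstF z).length) :=
    TM2Iter.eval_mono G₁ h3
  simp only [eval_add, eval_comp, eval_ofNat]
  omega

/-- **The fold loop with pieces of polynomial size is in `FP`.** [cite: AroraBarakCC2009, §1.3] -/
theorem foldLoop_mem_FP_of_poly {op f : List Bool → List Bool} (hop : op ∈ FP) (G₁ : Polynomial ℕ)
    (hopg : ∀ w, (op w).length ≤ (fstF w).length + G₁.eval (sndF w).length) (hf : f ∈ FP)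
    (G₂ : Polynomial ℕ) (hfg : ∀ w, (f w).length ≤ G₂.eval (fstF w).length) (p : Polynomial ℕ) :
    foldLoop op f p ∈ FP :=
  loopFn_mem_FP_of_poly (foldBody_mem_FP hop hf) (G₁.comp G₂ + 4) (length_foldBody_le_poly hopg hfg) p

/-- Running a fold from a context `x₀` and a unary round count `1^K`: the record
`⟨x₀, ⟨bin K, ⟨ε, ε⟩⟩⟩`. [folklore] -/
def foldInit (ctx cnt : List Bool → List Bool) : List Bool → List Bool :=
  fanoutFn ctx (fanoutFn (lenBinF ∘ cnt) fun _ => boolPair [] [])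

/-- `foldInit ctx cnt ∈ FP`. [folklore] -/
theorem foldInit_mem_FP {ctx cnt : List Bool → List Bool} (hc : ctx ∈ FP) (hn : cnt ∈ FP) :
    foldInit ctx cnt ∈ FP :=
  fanoutFn_mem_FP hc (fanoutFn_mem_FP (comp_mem_FP lenBinF_mem_FP hn) (const_mem_FP _))

/-- Value of `foldInit`. [folklore] -/
theorem foldInit_apply (ctx cnt : List Bool → List Bool) (w : List Bool) :
    foldInit ctx cnt w = boolPair (ctx w) (boolPair (encodeNat (cnt w).length) (boolPair (ones 0) [])) := by
  simp [foldInit, ones]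

/-- **The run of a fold**: `runFold op f ctx cnt w = foldAcc op f (ctx w) 0 |cnt w| ε` whenever
`|cnt w| ≤ |ctx w|`. [folklore] -/
def runFold (op f ctx cnt : List Bool → List Bool) : List Bool → List Bool :=
  sndPow 2 ∘ foldLoop op f X ∘ foldInit ctx cnt

/-- `runFold … ∈ FP` (polynomial-growth form). [cite: AroraBarakCC2009, §1.3] -/
theorem runFold_mem_FP {op f ctx cnt : List Bool → List Bool} (hop : op ∈ FP) (G₁ : Polynomial ℕ)
    (hopg : ∀ w, (op w).length ≤ (fstF w).length + G₁.eval (sndF w).length) (hf : f ∈ FP)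
    (G₂ : Polynomial ℕ) (hfg : ∀ w, (f w).length ≤ G₂.eval (fstF w).length)
    (hc : ctx ∈ FP) (hn : cnt ∈ FP) : runFold op f ctx cnt ∈ FP :=
  comp_mem_FP (sndPow_mem_FP 2) (comp_mem_FP (foldLoop_mem_FP_of_poly hop G₁ hopg hf G₂ hfg X)
    (foldInit_mem_FP hc hn))

/-- **Value of the run of a fold.** [folklore] -/
theorem runFold_apply (op f ctx cnt : List Bool → List Bool) {w : List Bool}
    (h : (cnt w).length ≤ (ctx w).length) :
    runFold op f ctx cnt w = foldAcc op f (ctx w) 0 (cnt w).length [] := by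
  simp only [runFold, Function.comp_apply, foldInit_apply]
  rw [foldLoop_apply op f (by simpa using h) 0 []]
  simp [sndPow]

end Brick

/-! ### Coded lists: the two codings agree; injectivity -/

/-- The two nested-pair list codings of the tree agree: `OracleCompose.body = encList` (twin of
`Literature.Barriers.HubbardSuperconductivity.body_eq_encList`, which lives in a barrier file that a
complexity file should not import; librarian consolidation candidate). [folklore] -/
theorem body_eq_encList : ∀ l : List (List Bool), body l = encList l
  | [] => rfl
  | a :: l => by rw [body_cons, encList_cons, body_eq_encList l]

/-- `encList` is injective (twin of `ModExpBlock.encList_injective` in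
`Cryptography/ShorModExpBlock.lean`, not importable here at reasonable cost). [folklore] -/
theorem encList_injective' : Function.Injective encList := fun l l' h => by
  rw [← decNil_encList l, ← decNil_encList l', h]

/-- `nthItemFn ⟨1ʲ, encList l⟩ = l[j]` (`ε` past the end). [folklore] -/
theorem nthItemFn_encList (j : ℕ) (l : List (List Bool)) :
    nthItemFn (boolPair (ones j) (encList l)) = l.getD j [] := by
  rw [← body_eq_encList, nthItemFn_body]

namespace GSRef

/-! ### The hash check `HashesToZero u d b v` -/

/-! Argument of the row pieces: `z = ⟨x₀, 1ʲ⟩` with `x₀ = ⟨u, ⟨1^d, ⟨1^b, v⟩⟩⟩`. -/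

/-- The coin string `u` of a hash argument. [folklore] -/
def huF : List Bool → List Bool := nthF 0 ∘ fstF
/-- `1^d` of a hash argument. [folklore] -/
def hdF : List Bool → List Bool := nthF 1 ∘ fstF
/-- The hashed string `v` of a hash argument. [folklore] -/
def hvF : List Bool → List Bool := sndPow 2 ∘ fstF
/-- The coins from row `j` on: `u ⇂ j (d+1)`. [folklore] -/
def rowF : List Bool → List Bool := dropFn ∘ fanoutFn (umulFn ∘ fanoutFn sndF (List.cons true ∘ hdF)) huF
/-- The `𝔽₂` inner product of row `j` with `v`, one bit. [folklore] -/
def dotF : List Bool → List Bool := andParityFn ∘ fanoutFn rowF hvF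
/-- The offset bit of row `j`. [folklore] -/
def offF : List Bool → List Bool := headBitFn ∘ dropFn ∘ fanoutFn hdF rowF
/-- The parity of row `j` (`Stockmeyer.rowParity`), one bit. [folklore] -/
def rowParF : List Bool → List Bool := xorFn dotF offF
/-- The failure marker of row `j`: `[1]` if the row parity is `1`, `ε` otherwise. [folklore] -/
def rowFailF : List Bool → List Bool := iteFn rowParF (fun _ => [true]) fun _ => []

/-- **The list of failing rows** (one `1` per row `j < b` with nonzero parity). [folklore] -/
def hashFailsFn : List Bool → List Bool := runFold appF rowFailF id (nthF 2)

/-- **The hash check**: `[HashesToZero u d b v]`. [cite: AroraBarakCC2009, §8.2.2] -/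
def hashOkFn : List Bool → List Bool := isNilFn ∘ hashFailsFn

/-- `rowF ∈ FP`. [folklore] -/
theorem rowF_mem_FP : rowF ∈ FP :=
  comp_mem_FP dropFn_mem_FP (fanoutFn_mem_FP (comp_mem_FP umulFn_mem_FP (fanoutFn_mem_FP sndF_mem_FP
    (comp_mem_FP (cons_mem_FP true) (comp_mem_FP (nthF_mem_FP 1) fstF_mem_FP))))
    (comp_mem_FP (nthF_mem_FP 0) fstF_mem_FP))
/-- `dotF ∈ FP`. [folklore] -/
theorem dotF_mem_FP : dotF ∈ FP :=
  comp_mem_FP andParityFn_mem_FP (fanoutFn_mem_FP rowF_mem_FP (comp_mem_FP (sndPow_mem_FP 2) fstF_mem_FP))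
/-- `offF ∈ FP`. [folklore] -/
theorem offF_mem_FP : offF ∈ FP :=
  comp_mem_FP headBitFn_mem_FP (comp_mem_FP dropFn_mem_FP (fanoutFn_mem_FP
    (comp_mem_FP (nthF_mem_FP 1) fstF_mem_FP) rowF_mem_FP))
/-- `rowParF ∈ FP`. [folklore] -/
theorem rowParF_mem_FP : rowParF ∈ FP := xorFn_mem_FP dotF_mem_FP offF_mem_FP
/-- `rowFailF ∈ FP`. [folklore] -/
theorem rowFailF_mem_FP : rowFailF ∈ FP := iteFn_mem_FP rowParF_mem_FP (const_mem_FP _) (const_mem_FP _)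

/-- `dotF` is one bit on every input. [folklore] -/
theorem dotF_eq (z : List Bool) :
    dotF z = [decide (Odd (((rowF z).zipWith (· && ·) (hvF z)).count true))] := by
  simp [dotF]

/-- `offF` is one bit on every input. [folklore] -/
theorem offF_eq (z : List Bool) : offF z = [((rowF z).drop (hdF z).length).headD false] := by
  have : dropFn (boolPair (hdF z) (rowF z)) = (rowF z).drop (hdF z).length := dropFn_boolPair _ _
  simp [offF, this]

/-- Value of `rowParF`: one bit on every input. [folklore] -/
theorem rowParF_eq (z : List Bool) : rowParF z =
    [xor (decide (Odd (((rowF z).zipWith (· && ·) (hvF z)).count true)))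
      (((rowF z).drop (hdF z).length).headD false)] :=
  xorFn_apply (dotF_eq z) (offF_eq z)

/-- The failure marker is at most one symbol. [folklore] -/
theorem length_rowFailF_le (z : List Bool) : (rowFailF z).length ≤ 1 := by
  rw [rowFailF, iteFn_apply (rowParF_eq z)]
  split_ifs <;> simp

/-- `hashFailsFn ∈ FP`. [folklore] -/
theorem hashFailsFn_mem_FP : hashFailsFn ∈ FP :=
  runFold_mem_FP appF_mem_FP X (fun w => by simpa using length_appF_le w) rowFailF_mem_FP 1
    (fun w => by simpa using length_rowFailF_le w) (PolyTimeComputable.id _) (nthF_mem_FP 2)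

/-- `hashOkFn ∈ FP`. [folklore] -/
theorem hashOkFn_mem_FP : hashOkFn ∈ FP := comp_mem_FP isNilFn_mem_FP hashFailsFn_mem_FP

/-- `hashOkFn` is one bit. [folklore] -/
theorem oneBit_hashOkFn : OneBit hashOkFn := oneBit_isNilFn.comp _

/-- The row piece on a genuine hash argument: the failure marker of `rowParity u d v j`.
[folklore] -/
theorem rowFailF_apply (u v : List Bool) (d b j : ℕ) :
    rowFailF (boolPair (boolPair u (boolPair (ones d) (boolPair (ones b) v))) (ones j)) =
      if rowParity u d v j then [true] else [] := by
  set z := boolPair (boolPair u (boolPair (ones d) (boolPair (ones b) v))) (ones j) with hz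
  have hrow : rowF z = u.drop (rowStart d j) := by
    have h1 : umulFn (boolPair (ones j) (true :: ones d)) = ones (j * (d + 1)) := by
      rw [show true :: ones d = ones (d + 1) by simp [ones, List.replicate_succ], umulFn_boolPair]
    have h2 : rowF z = dropFn (boolPair (umulFn (boolPair (ones j) (true :: ones d))) u) := by
      simp [hz, rowF, huF, hdF, nthF]
    rw [h2, h1, dropFn_boolPair, rowStart]
    simp [ones]
  have hv : hvF z = v := by simp [hz, hvF, sndPow]
  have hd : (hdF z).length = d := by simp [hz, hdF, nthF, ones]
  rw [rowFailF, iteFn_apply (rowParF_eq z), hrow, hv, hd]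
  have hpar : (xor (decide (Odd (((u.drop (rowStart d j)).zipWith (· && ·) v).count true)))
      (((u.drop (rowStart d j)).drop d).headD false)) = rowParity u d v j := by
    rw [rowParity, List.drop_drop, StockMachine.headD_drop]
  rw [hpar]

/-- **Value of `hashFailsFn`**: the concatenated failure markers of the rows `j < b`. [folklore] -/
theorem hashFailsFn_apply (u v : List Bool) (d b : ℕ) :
    hashFailsFn (boolPair u (boolPair (ones d) (boolPair (ones b) v))) =
      ccat (fun j => if rowParity u d v j then [true] else []) b := by
  set x₀ := boolPair u (boolPair (ones d) (boolPair (ones b) v)) with hx₀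
  have hcnt : (nthF 2 x₀).length = b := by simp [hx₀, nthF, ones]
  have hle : (nthF 2 x₀).length ≤ (id x₀).length := by
    rw [hcnt]; simp only [id, hx₀, length_boolPair, ones, List.length_replicate]; omega
  rw [hashFailsFn, runFold_apply _ _ _ _ hle, hcnt, foldAcc_appF]
  simp only [id, List.nil_append, Nat.zero_add]
  exact ccat_congr fun j _ => rowFailF_apply u v d b j

/-- A concatenation of pieces is empty iff every piece is. [folklore] -/
theorem ccat_eq_nil_iff (g : ℕ → List Bool) : ∀ n : ℕ, ccat g n = [] ↔ ∀ j < n, g j = []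
  | 0 => by simp
  | n + 1 => by
    rw [ccat_succ, List.append_eq_nil_iff, ccat_eq_nil_iff g n]
    constructor
    · rintro ⟨h1, h2⟩ j hj
      rcases Nat.lt_succ_iff_lt_or_eq.1 hj with h | rfl
      exacts [h1 j h, h2]
    · exact fun h => ⟨fun j hj => h j (Nat.lt_succ_of_lt hj), h n (Nat.lt_succ_self n)⟩

/-- **Value of the hash check**: `hashOkFn ⟨u, ⟨1^d, ⟨1^b, v⟩⟩⟩ = [1] ↔ HashesToZero u d b v`.
[cite: AroraBarakCC2009, §8.2.2] -/
theorem hashOkFn_eq_true_iff (u v : List Bool) (d b : ℕ) :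
    hashOkFn (boolPair u (boolPair (ones d) (boolPair (ones b) v))) = [true] ↔ HashesToZero u d b v := by
  rw [hashOkFn, Function.comp_apply, hashFailsFn_apply]
  have hiff : ccat (fun j => if rowParity u d v j then [true] else []) b = [] ↔ HashesToZero u d b v := by
    rw [ccat_eq_nil_iff, HashesToZero]
    refine forall_congr' fun j => forall_congr' fun _ => ?_
    by_cases hp : rowParity u d v j <;> simp [hp]
  rw [isNilFn, List.singleton_inj, decide_eq_true_iff, hiff]

/-! ### The bucket of a Merlin move, in unary -/

/-- `splitOnes` counts the leading `1`s. [folklore] -/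
theorem splitOnes_fst_eq_leadOnes : ∀ u : List Bool, (splitOnes u).1 = GoldwasserSipser.leadOnes u
  | [] => rfl
  | true :: u => by simp only [splitOnes, GoldwasserSipser.leadOnes, splitOnes_fst_eq_leadOnes u]
  | false :: u => rfl

variable (W : IPVerifier) (γ : ℕ)

/-- `1^ℓ`, `ℓ = coins(|x|)` of the simulated verifier, from `x`. [folklore] -/
def ellU : List Bool → List Bool := polyFn W.coins
/-- `1^m`, `m = msgLen(|x|)`, from `x`. [folklore] -/
def emU : List Bool → List Bool := polyFn W.msgLen
/-- `1^β`, `β = |bin (ℓ + 1)|` (the bucket exponent: `ℓ + 1 < 2^β`), from `x`. [folklore] -/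
def betaU : List Bool → List Bool := onesFn ∘ lenBinF ∘ List.cons true ∘ ellU W

/-- Values of the unary parameters. [folklore] -/
@[simp] theorem ellU_apply (x : List Bool) : ellU W x = ones (W.coins.eval x.length) := polyFn_apply _ _
/-- Values of the unary parameters. [folklore] -/
@[simp] theorem emU_apply (x : List Bool) : emU W x = ones (W.msgLen.eval x.length) := polyFn_apply _ _
/-- Values of the unary parameters: `β = size (ℓ + 1)`. [folklore] -/
@[simp] theorem betaU_apply (x : List Bool) : betaU W x = ones (W.coins.eval x.length + 1).size := by
  simp [betaU, onesFn, ones, TM2Pass.length_encodeNat_eq_size, unaryEncodeNat_eq_replicate]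

/-- **The bucket announced by a Merlin move**, in unary: `bktU ⟨x, w⟩ = 1^{bktOf w}` — the leading
`1`s of the `ℓ + 1` bits after the two messages of length `m`. [cite: AroraBarakCC2009, §8.2.3] -/
def bktU : List Bool → List Bool :=
  onesPrefixFn ∘ takeFn ∘ fanoutFn (List.cons true ∘ ellU W ∘ fstF)
    (dropFn ∘ fanoutFn (appF ∘ fanoutFn (emU W ∘ fstF) (emU W ∘ fstF)) sndF)

/-- `bktU ∈ FP`. [folklore] -/
theorem bktU_mem_FP : bktU W ∈ FP :=
  comp_mem_FP onesPrefixFn_mem_FP (comp_mem_FP takeFn_mem_FP (fanoutFn_mem_FP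
    (comp_mem_FP (cons_mem_FP true) (comp_mem_FP (polyFn_mem_FP _) fstF_mem_FP))
    (comp_mem_FP dropFn_mem_FP (fanoutFn_mem_FP (comp_mem_FP appF_mem_FP (fanoutFn_mem_FP
      (comp_mem_FP (polyFn_mem_FP _) fstF_mem_FP) (comp_mem_FP (polyFn_mem_FP _) fstF_mem_FP))) sndF_mem_FP))))

/-- **Value of `bktU`**: the bucket of the move, for the parameters of input length `|x|`.
[folklore] -/
theorem bktU_apply (x w : List Bool) : bktU W (boolPair x w) =
    ones (GoldwasserSipser.leadOnes ((w.drop (2 * W.msgLen.eval x.length)).take (W.coins.eval x.length + 1))) := by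
  simp only [bktU, Function.comp_apply, fanoutFn_apply, fstF_boolPair, sndF_boolPair, ellU_apply, emU_apply,
    appF_boolPair, dropFn_boolPair, takeFn_boolPair, onesPrefixFn, splitOnes_fst_eq_leadOnes]
  simp [ones, Nat.two_mul]

/-! ### Replaying the simulated verifier against recorded prover answers -/

/-- `|nthItemFn ⟨u, L⟩| ≤ |L|` (twin of `PPolyTuring.length_nthItemFn_boolPair_le` in
`PPolyTuringClosure.lean`, a file far outside this import closure). [folklore] -/
theorem length_nthItemFn_boolPair_le (u L : List Bool) : (nthItemFn (boolPair u L)).length ≤ L.length := by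
  rw [nthItemFn_boolPair]
  have hiter : ∀ (k : ℕ) (L : List Bool), (sndF^[k] L).length ≤ L.length := by
    intro k; induction k with
    | zero => intro L; exact le_rfl
    | succ k ih => intro L; rw [Function.iterate_succ_apply]
                   exact (ih _).trans (by have := length_fstF_sndF_le L; omega)
  have h1 := length_fstF_sndF_le (sndF^[u.length] L)
  have h2 := hiter u.length L
  omega

/-- The verifier's next message from a view, truncated / padded to `m = msgLen(|x|)` symbols
(`take m (· ++ 0^m)` is `takeD m · false`): `⟨x, view⟩ ↦ W(view)↾↑m`. [cite: AroraBarakCC2009, Def. 8.6] -/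
def msgF : List Bool → List Bool :=
  takeFn ∘ fanoutFn (emU W ∘ fstF) (appF ∘ fanoutFn (W.next ∘ sndF) (zerosFn ∘ emU W ∘ fstF))

/-- `msgF ∈ FP` for a polynomial-time verifier. [folklore] -/
theorem msgF_mem_FP (hW : W.IsPolyTime) : msgF W ∈ FP :=
  comp_mem_FP takeFn_mem_FP (fanoutFn_mem_FP (comp_mem_FP (polyFn_mem_FP _) fstF_mem_FP)
    (comp_mem_FP appF_mem_FP (fanoutFn_mem_FP (comp_mem_FP hW.1 sndF_mem_FP)
      (comp_mem_FP zerosFn_mem_FP (comp_mem_FP (polyFn_mem_FP _) fstF_mem_FP)))))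

/-- `take m (s ++ 0^m) = takeD m s`. [folklore] -/
theorem take_append_replicate_eq_takeD : ∀ (m : ℕ) (s : List Bool),
    (s ++ List.replicate m false).take m = s.takeD m false
  | 0, s => by simp
  | m + 1, [] => by simp [List.take_replicate, List.replicate_succ]
  | m + 1, b :: s => by
    rw [List.cons_append, List.take_succ_cons, List.takeD_succ]
    simp only [List.head?_cons, Option.getD_some, List.tail_cons]
    rw [List.replicate_succ', ← List.append_assoc, List.take_append_of_le_length (by simp),
      take_append_replicate_eq_takeD m s]

/-- **Value of `msgF`**: `W`'s message after the view, as `IPVerifier.vmsg`. [folklore] -/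
theorem msgF_apply (x r : List Bool) (t : List (List Bool)) :
    msgF W (boolPair x (IPVerifier.view x r t)) = W.vmsg x (W.msgLen.eval x.length) r t := by
  simp only [msgF, Function.comp_apply, fanoutFn_apply, fstF_boolPair, sndF_boolPair, emU_apply, appF_boolPair,
    zerosFn_apply, takeFn_boolPair, IPVerifier.vmsg]
  simp only [ones, List.length_replicate]
  exact take_append_replicate_eq_takeD _ _

/-- `|msgF z| ≤ msgLen (|fstF z|)` on every input. [folklore] -/
theorem length_msgF_le (z : List Bool) : (msgF W z).length ≤ W.msgLen.eval (fstF z).length := by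
  have : msgF W z = takeFn (boolPair (emU W (fstF z)) (appF (boolPair (W.next (sndF z)) (zerosFn (emU W (fstF z)))))) := by
    simp [msgF]
  rw [this, takeFn_boolPair, emU_apply]
  refine (List.length_take_le _ _).trans ?_
  simp [ones]

/-- **The replay operation** on `⟨acc, ⟨x, ⟨r, a'⟩⟩⟩` with `acc = ⟨1^{|P|}, encList P⟩` (read through
its two projections, so that the empty accumulator `ε` stands for `P = []`): append the verifier's
message `a = W(x, r, P)↾↑m` and the recorded answer `a'↾m`: `⟨11·1^{|P|}, encList (P ++ [a, a'↾m])⟩`.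
[cite: AroraBarakCC2009, Def. 8.6] -/
def replayOp : List Bool → List Bool :=
  fanoutFn (List.cons true ∘ List.cons true ∘ fstF ∘ fstF)
    (appF ∘ fanoutFn (sndF ∘ fstF)
      (fanoutFn (msgF W ∘ fanoutFn (nthF 0 ∘ sndF)
          (fanoutFn (nthF 0 ∘ sndF) (fanoutFn (nthF 1 ∘ sndF) (fanoutFn (fstF ∘ fstF) (sndF ∘ fstF)))))
        (fanoutFn (takeFn ∘ fanoutFn (emU W ∘ nthF 0 ∘ sndF) (sndPow 1 ∘ sndF)) fun _ => [])))

/-- `replayOp ∈ FP`. [folklore] -/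
theorem replayOp_mem_FP (hW : W.IsPolyTime) : replayOp W ∈ FP :=
  fanoutFn_mem_FP (comp_mem_FP (cons_mem_FP true) (comp_mem_FP (cons_mem_FP true) (comp_mem_FP fstF_mem_FP fstF_mem_FP)))
    (comp_mem_FP appF_mem_FP (fanoutFn_mem_FP (comp_mem_FP sndF_mem_FP fstF_mem_FP)
      (fanoutFn_mem_FP (comp_mem_FP (msgF_mem_FP W hW) (fanoutFn_mem_FP (comp_mem_FP (nthF_mem_FP 0) sndF_mem_FP)
        (fanoutFn_mem_FP (comp_mem_FP (nthF_mem_FP 0) sndF_mem_FP) (fanoutFn_mem_FP (comp_mem_FP (nthF_mem_FP 1) sndF_mem_FP)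
          (fanoutFn_mem_FP (comp_mem_FP fstF_mem_FP fstF_mem_FP) (comp_mem_FP sndF_mem_FP fstF_mem_FP))))))
        (fanoutFn_mem_FP (comp_mem_FP takeFn_mem_FP (fanoutFn_mem_FP
          (comp_mem_FP (polyFn_mem_FP _) (comp_mem_FP (nthF_mem_FP 0) sndF_mem_FP)) (comp_mem_FP (sndPow_mem_FP 1) sndF_mem_FP)))
          (const_mem_FP [])))))

/-- **Value of the replay operation.** [folklore] -/
theorem replayOp_apply {acc : List Bool} {P : List (List Bool)} (hU : fstF acc = ones P.length)
    (hE : sndF acc = encList P) (x r a' : List Bool) :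
    replayOp W (boolPair acc (boolPair x (boolPair r a'))) =
      boolPair (ones (P.length + 2)) (encList (P ++ [W.vmsg x (W.msgLen.eval x.length) r P,
        a'.take (W.msgLen.eval x.length)])) := by
  have hview : boolPair x (boolPair r (boolPair (fstF acc) (sndF acc))) = IPVerifier.view x r P := by
    rw [hU, hE, IPVerifier.view, ← Boards.encMoves_eq P]
  have hmsg : msgF W (boolPair x (boolPair x (boolPair r (boolPair (fstF acc) (sndF acc))))) =
      W.vmsg x (W.msgLen.eval x.length) r P := by rw [hview, msgF_apply]
  simp only [replayOp, Function.comp_apply, fanoutFn_apply, fstF_boolPair, sndF_boolPair, nthF_zero, nthF_succ_boolPair,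
    nthF_zero_boolPair, sndPow_succ_boolPair, sndPow_zero_boolPair, appF_boolPair, emU_apply, takeFn_boolPair]
  rw [hmsg, hU, hE, Boards.encList_append]
  simp [ones, List.replicate_succ, encList_cons]

/-- **Growth of the replay operation**: `|replayOp ⟨acc, pc⟩| ≤ |acc| + (4 msgLen + 10)(|pc|)`.
[folklore] -/
theorem length_replayOp_le (q : List Bool) :
    (replayOp W q).length ≤ (fstF q).length + (4 * W.msgLen + 10).eval (sndF q).length := by
  have hmono : W.msgLen.eval (nthF 0 (sndF q)).length ≤ W.msgLen.eval (sndF q).length :=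
    TM2Iter.eval_mono _ (length_nthF_le 0 _)
  have h1 := length_fstF_sndF_le (fstF q)
  have h2 : (msgF W (fanoutFn (nthF 0 ∘ sndF) (fanoutFn (nthF 0 ∘ sndF) (fanoutFn (nthF 1 ∘ sndF)
      (fanoutFn (fstF ∘ fstF) (sndF ∘ fstF)))) q)).length ≤ W.msgLen.eval (sndF q).length :=
    (length_msgF_le W _).trans (by rw [fanoutFn_apply, fstF_boolPair]; exact hmono)
  have h3 : (takeFn (fanoutFn (emU W ∘ nthF 0 ∘ sndF) (sndPow 1 ∘ sndF) q)).length ≤ W.msgLen.eval (sndF q).length := by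
    rw [fanoutFn_apply, takeFn_boolPair, Function.comp_apply, Function.comp_apply, emU_apply]
    exact (List.length_take_le _ _).trans (by simpa [ones] using hmono)
  rw [replayOp, length_fanoutFn]
  simp only [Function.comp_apply, List.length_cons, fanoutFn_apply, appF_boolPair, List.length_append,
    length_boolPair, List.length_nil]
  simp only [fanoutFn_apply, Function.comp_apply] at h2 h3
  simp only [eval_add, eval_mul, eval_ofNat]
  omega

/-- **The replay piece** `⟨⟨x, ⟨r, E⟩⟩, 1ⁱ⟩ ↦ ⟨x, ⟨r, E[2i+1]⟩⟩` (the `i`-th recorded prover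
answer). [folklore] -/
def replayPiece : List Bool → List Bool :=
  fanoutFn (nthF 0 ∘ fstF) (fanoutFn (nthF 1 ∘ fstF)
    (nthItemFn ∘ fanoutFn (List.cons true ∘ appF ∘ fanoutFn sndF sndF) (sndPow 1 ∘ fstF)))

/-- `replayPiece ∈ FP`. [folklore] -/
theorem replayPiece_mem_FP : replayPiece ∈ FP :=
  fanoutFn_mem_FP (comp_mem_FP (nthF_mem_FP 0) fstF_mem_FP) (fanoutFn_mem_FP (comp_mem_FP (nthF_mem_FP 1) fstF_mem_FP)
    (comp_mem_FP nthItemFn_mem_FP (fanoutFn_mem_FP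
      (comp_mem_FP (cons_mem_FP true) (comp_mem_FP appF_mem_FP (fanoutFn_mem_FP sndF_mem_FP sndF_mem_FP)))
      (comp_mem_FP (sndPow_mem_FP 1) fstF_mem_FP))))

/-- **Value of the replay piece.** [folklore] -/
theorem replayPiece_apply (x r : List Bool) (τ : List (List Bool)) (i : ℕ) :
    replayPiece (boolPair (boolPair x (boolPair r (encList τ))) (ones i)) =
      boolPair x (boolPair r (τ.getD (2 * i + 1) [])) := by
  have hidx : true :: (ones i ++ ones i) = ones (2 * i + 1) := by
    simp [ones, List.replicate_succ, Nat.two_mul]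
  simp only [replayPiece, Function.comp_apply, fanoutFn_apply, fstF_boolPair, sndF_boolPair, nthF_zero, nthF_succ_boolPair,
    nthF_zero_boolPair, sndPow_succ_boolPair, sndPow_zero_boolPair, appF_boolPair, hidx, nthItemFn_encList]

/-- **Growth of the replay piece**: `|replayPiece z| ≤ 5 |fstF z| + 6`. [folklore] -/
theorem length_replayPiece_le (z : List Bool) : (replayPiece z).length ≤ (5 * X + 6).eval (fstF z).length := by
  have h0 := length_nthF_le 0 (fstF z)
  have h1 := length_nthF_le 1 (fstF z)
  have h2 : (nthItemFn (fanoutFn (List.cons true ∘ appF ∘ fanoutFn sndF sndF) (sndPow 1 ∘ fstF) z)).length ≤ (fstF z).length := by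
    rw [fanoutFn_apply]
    exact (length_nthItemFn_boolPair_le _ _).trans (length_sndPow_le 1 _)
  rw [replayPiece, length_fanoutFn, length_fanoutFn]
  simp only [Function.comp_apply, eval_add, eval_mul, eval_X, eval_ofNat] at h2 ⊢
  omega

/-- **The replay** of `W` on coins `r` against the answers recorded in `encList τ`, for `i` rounds
(`⟨x, ⟨r, ⟨encList τ, 1ⁱ⟩⟩⟩ ↦ ⟨1^{2i}, encList (replayed transcript)⟩`).
[cite: AroraBarakCC2009, Def. 8.6] -/
def replayFn : List Bool → List Bool :=
  runFold (replayOp W) replayPiece (fanoutFn (nthF 0) (fanoutFn (nthF 1) (nthF 2))) (sndPow 2)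

/-- `replayFn ∈ FP`. [folklore] -/
theorem replayFn_mem_FP (hW : W.IsPolyTime) : replayFn W ∈ FP :=
  runFold_mem_FP (replayOp_mem_FP W hW) _ (length_replayOp_le W) replayPiece_mem_FP _ length_replayPiece_le
    (fanoutFn_mem_FP (nthF_mem_FP 0) (fanoutFn_mem_FP (nthF_mem_FP 1) (nthF_mem_FP 2))) (sndPow_mem_FP 2)

/-- **The model of the replay**: `i` rounds of "verifier message, recorded answer `τ[2i+1]`".
[cite: AroraBarakCC2009, Def. 8.6] -/
def replayModel (x r : List Bool) (m : ℕ) (τ : List (List Bool)) : ℕ → List (List Bool)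
  | 0 => []
  | i + 1 => replayModel x r m τ i ++ [W.vmsg x m r (replayModel x r m τ i), (τ.getD (2 * i + 1) []).take m]

/-- The replay model has `2i` messages. [folklore] -/
@[simp] theorem length_replayModel (x r : List Bool) (m : ℕ) (τ : List (List Bool)) :
    ∀ i : ℕ, (replayModel W x r m τ i).length = 2 * i
  | 0 => rfl
  | i + 1 => by rw [replayModel, List.length_append, length_replayModel x r m τ i]; simp; ring

/-- The fold of the replay computes the replay model. [folklore] -/
theorem foldAcc_replay (x r : List Bool) (τ : List (List Bool)) :
    ∀ i : ℕ, foldAcc (replayOp W) replayPiece (boolPair x (boolPair r (encList τ))) 0 i [] =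
      if i = 0 then [] else boolPair (ones (2 * i)) (encList (replayModel W x r (W.msgLen.eval x.length) τ i))
  | 0 => rfl
  | i + 1 => by
    rw [foldAcc_succ', foldAcc_replay x r τ i, Nat.zero_add, replayPiece_apply, if_neg (Nat.succ_ne_zero i)]
    split_ifs with hi
    · subst hi
      rw [replayOp_apply W (P := []) (by simp [ones]) (by simp)]
      simp [replayModel]
    · rw [replayOp_apply W (P := replayModel W x r (W.msgLen.eval x.length) τ i) (by simp) (by simp)]
      simp only [length_replayModel, replayModel]
      congr 2

/-- **Value of the replay.** [cite: AroraBarakCC2009, Def. 8.6] -/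
theorem replayFn_apply (x r : List Bool) (τ : List (List Bool)) {i : ℕ} (hi : 0 < i) (hiτ : i ≤ (encList τ).length) :
    replayFn W (boolPair x (boolPair r (boolPair (encList τ) (ones i)))) =
      boolPair (ones (2 * i)) (encList (replayModel W x r (W.msgLen.eval x.length) τ i)) := by
  rw [replayFn, runFold_apply]
  · simp only [fanoutFn_apply, nthF_zero_boolPair, nthF_succ_boolPair, nthF_zero, fstF_boolPair, sndPow_succ_boolPair,
      sndPow_zero_boolPair]
    rw [show (ones i).length = i by simp [ones], foldAcc_replay, if_neg hi.ne']
  · simp only [fanoutFn_apply, nthF_zero_boolPair, nthF_succ_boolPair, nthF_zero, fstF_boolPair, sndPow_succ_boolPair,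
      sndPow_zero_boolPair, length_boolPair]
    simp [ones]; omega

/-- The replay of no round is empty. [folklore] -/
theorem replayFn_apply_zero (x r E : List Bool) :
    replayFn W (boolPair x (boolPair r (boolPair E (ones 0)))) = [] := by
  rw [replayFn, runFold_apply]
  · simp [fanoutFn_apply, nthF, sndPow, ones]
  · simp [sndPow, ones]

/-! ### The round record and the checks of the referee

The referee walks along the history with the record `⟨x, ⟨1^κ, ⟨1^j, ⟨encList τ, ⟨1^i, rest⟩⟩⟩⟩⟩`:
the input, the current claim, the announced bucket, the private-coin transcript so far (its code
and its number `i` of rounds), and the coded list of the moves still to be read (`rest = ⟨u, ⟨w, …⟩⟩`: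
Arthur's next hash `u`, Merlin's next move `w`). -/

variable (kf : ℕ)

/-- The round record. [folklore] -/
def rec6 (x K J E U rest : List Bool) : List Bool :=
  boolPair x (boolPair K (boolPair J (boolPair E (boolPair U rest))))

/-- Projections of the round record. [folklore] -/
theorem rec6_proj (x K J E U u w rest : List Bool) :
    nthF 0 (rec6 x K J E U (boolPair u (boolPair w rest))) = x ∧ nthF 1 (rec6 x K J E U (boolPair u (boolPair w rest))) = K ∧
    nthF 2 (rec6 x K J E U (boolPair u (boolPair w rest))) = J ∧ nthF 3 (rec6 x K J E U (boolPair u (boolPair w rest))) = E ∧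
    nthF 4 (rec6 x K J E U (boolPair u (boolPair w rest))) = U ∧ nthF 5 (rec6 x K J E U (boolPair u (boolPair w rest))) = u ∧
    nthF 6 (rec6 x K J E U (boolPair u (boolPair w rest))) = w ∧ sndPow 6 (rec6 x K J E U (boolPair u (boolPair w rest))) = rest := by
  simp [rec6, nthF, sndPow]

/-- Merlin's verifier message `w↾m` read off the record. [folklore] -/
def vmU : List Bool → List Bool := takeFn ∘ fanoutFn (emU W ∘ nthF 0) (nthF 6)
/-- Merlin's answer `(w⇂m)↾m` read off the record. [folklore] -/
def pmU : List Bool → List Bool := takeFn ∘ fanoutFn (emU W ∘ nthF 0) (dropFn ∘ fanoutFn (emU W ∘ nthF 0) (nthF 6))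
/-- **The number of hash rows of the round**, `1^{((κ ∸ (j+1+β)) ∸ γ)}` (truncated subtraction is
`drop` on unary strings). [cite: AroraBarakCC2009, §8.2.3] -/
def bLenU : List Bool → List Bool :=
  dropFn ∘ fanoutFn (fun _ => ones γ)
    (dropFn ∘ fanoutFn (List.cons true ∘ appF ∘ fanoutFn (nthF 2) (betaU W ∘ nthF 0)) (nthF 1))
/-- **The hash check of the round**: `[h_u (w↾m) = 0]` with `bLen` rows of `m + 1` coins.
[cite: AroraBarakCC2009, §8.2.2] -/
def roundOkF : List Bool → List Bool :=
  hashOkFn ∘ fanoutFn (nthF 5) (fanoutFn (emU W ∘ nthF 0) (fanoutFn (bLenU W γ) (vmU W)))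
/-- **The round step of the record**: the claim becomes the announced bucket, the new bucket is
read off `w`, the transcript grows by `[w↾m, (w⇂m)↾m]`, two moves are consumed.
[cite: AroraBarakCC2009, §8.2.3] -/
def stepF : List Bool → List Bool :=
  fanoutFn (nthF 0) (fanoutFn (nthF 2) (fanoutFn (bktU W ∘ fanoutFn (nthF 0) (nthF 6))
    (fanoutFn (appF ∘ fanoutFn (nthF 3) (fanoutFn (vmU W) (fanoutFn (pmU W) fun _ => [])))
      (fanoutFn (List.cons true ∘ nthF 4) (sndPow 6)))))

/-- Merlin's coins `w↾ℓ` read off the record (last move). [folklore] -/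
def coinsU : List Bool → List Bool := takeFn ∘ fanoutFn (ellU W ∘ nthF 0) (nthF 6)
/-- **The final hash check**: `[h_u (w↾ℓ) = 0]` with `κ ∸ γ` rows of `ℓ + 1` coins. [cite: AroraBarakCC2009, §8.2.2] -/
def finalHashF : List Bool → List Bool :=
  hashOkFn ∘ fanoutFn (nthF 5) (fanoutFn (ellU W ∘ nthF 0)
    (fanoutFn (dropFn ∘ fanoutFn (fun _ => ones γ) (nthF 1)) (coinsU W)))
/-- The argument of the replay: `⟨x, ⟨r, ⟨encList τ, 1ⁱ⟩⟩⟩`. [folklore] -/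
def replayArgF : List Bool → List Bool := fanoutFn (nthF 0) (fanoutFn (coinsU W) (fanoutFn (nthF 3) (nthF 4)))
/-- **The consistency check**: replaying `W` on the coins against the recorded answers reproduces
the recorded transcript. [cite: AroraBarakCC2009, §8.2.3] -/
def consistF : List Bool → List Bool := eqPairFn ∘ fanoutFn (sndF ∘ replayFn W ∘ replayArgF W) (nthF 3)
/-- The code `enc` of the completed private-coin transcript: `τ` itself (`kf = 0`) or `τ` followed by
the verifier's last message (`kf = 1`). [cite: AroraBarakCC2009, Def. 8.6] -/
def lastMovesF : ℕ → List Bool → List Bool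
  | 0 => fanoutFn (appF ∘ fanoutFn (nthF 4) (nthF 4)) (nthF 3)
  | _ + 1 => fanoutFn (List.cons true ∘ appF ∘ fanoutFn (nthF 4) (nthF 4))
      (appF ∘ fanoutFn (nthF 3) (fanoutFn (msgF W ∘ fanoutFn (nthF 0)
        (fanoutFn (nthF 0) (fanoutFn (coinsU W) (fanoutFn (appF ∘ fanoutFn (nthF 4) (nthF 4)) (nthF 3))))) fun _ => []))
/-- **The acceptance check**: `W` with Merlin's coins accepts the completed transcript.
[cite: AroraBarakCC2009, Def. 8.6] -/
def acceptF : List Bool → List Bool :=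
  (fun v => encodeBool (W.verdict.boolIndicator v)) ∘ fanoutFn (nthF 0) (fanoutFn (coinsU W) (lastMovesF W kf))
/-- **The final test**: hash of the coins, consistency, acceptance. [cite: AroraBarakCC2009, §8.2.3] -/
def finalOkF : List Bool → List Bool := andFn (finalHashF W γ) (andFn (consistF W) (acceptF W kf))

/-- **The checks of the referee from a record with `n` rounds to go.** [cite: AroraBarakCC2009, §8.2.3] -/
def chkF : ℕ → List Bool → List Bool
  | 0 => finalOkF W γ kf
  | n + 1 => andFn (roundOkF W γ) (chkF n ∘ stepF W)

/-- **The initial record** of a referee input `⟨x, ⟨hdr, ⟨w₀, rest⟩⟩⟩`: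
`⟨x, ⟨1^{ℓ-1}, ⟨1^{bkt w₀}, ⟨ε, ⟨ε, rest⟩⟩⟩⟩⟩`. [cite: AroraBarakCC2009, §8.2.3] -/
def initRecF : List Bool → List Bool :=
  fanoutFn (nthF 0) (fanoutFn (dropFn ∘ fanoutFn (fun _ => [true]) (ellU W ∘ nthF 0))
    (fanoutFn (bktU W ∘ fanoutFn (nthF 0) (nthF 2)) (fanoutFn (fun _ => []) (fanoutFn (fun _ => []) (sndPow 2)))))

variable (R : ℕ)

/-- **The referee's test** on an input `⟨x, enc h⟩`. [cite: AroraBarakCC2009, §8.2.3] -/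
def gsRefFn : List Bool → List Bool := chkF W γ kf R ∘ initRecF W

/-- **The Goldwasser–Sipser referee** (as a language: the inputs passing the test).
[cite: AroraBarakCC2009, Thm. 8.12 (§8.2.3)] -/
def gsRef : Language Bool := (fanoutFn (fun _ => [true]) (gsRefFn W γ kf R)) ⁻¹' UnLe

/-! ### Polynomial time -/

/-- `vmU ∈ FP`. [folklore] -/
theorem vmU_mem_FP : vmU W ∈ FP :=
  comp_mem_FP takeFn_mem_FP (fanoutFn_mem_FP (comp_mem_FP (polyFn_mem_FP _) (nthF_mem_FP 0)) (nthF_mem_FP 6))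
/-- `pmU ∈ FP`. [folklore] -/
theorem pmU_mem_FP : pmU W ∈ FP :=
  comp_mem_FP takeFn_mem_FP (fanoutFn_mem_FP (comp_mem_FP (polyFn_mem_FP _) (nthF_mem_FP 0))
    (comp_mem_FP dropFn_mem_FP (fanoutFn_mem_FP (comp_mem_FP (polyFn_mem_FP _) (nthF_mem_FP 0)) (nthF_mem_FP 6))))
/-- `betaU ∈ FP`. [folklore] -/
theorem betaU_mem_FP : betaU W ∈ FP :=
  comp_mem_FP onesFn_mem_FP (comp_mem_FP lenBinF_mem_FP (comp_mem_FP (cons_mem_FP true) (polyFn_mem_FP _)))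
/-- `bLenU ∈ FP`. [folklore] -/
theorem bLenU_mem_FP : bLenU W γ ∈ FP :=
  comp_mem_FP dropFn_mem_FP (fanoutFn_mem_FP (const_mem_FP _) (comp_mem_FP dropFn_mem_FP (fanoutFn_mem_FP
    (comp_mem_FP (cons_mem_FP true) (comp_mem_FP appF_mem_FP (fanoutFn_mem_FP (nthF_mem_FP 2)
      (comp_mem_FP (betaU_mem_FP W) (nthF_mem_FP 0))))) (nthF_mem_FP 1))))
/-- `roundOkF ∈ FP`. [folklore] -/
theorem roundOkF_mem_FP : roundOkF W γ ∈ FP :=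
  comp_mem_FP hashOkFn_mem_FP (fanoutFn_mem_FP (nthF_mem_FP 5) (fanoutFn_mem_FP (comp_mem_FP (polyFn_mem_FP _) (nthF_mem_FP 0))
    (fanoutFn_mem_FP (bLenU_mem_FP W γ) (vmU_mem_FP W))))
/-- `stepF ∈ FP`. [folklore] -/
theorem stepF_mem_FP : stepF W ∈ FP :=
  fanoutFn_mem_FP (nthF_mem_FP 0) (fanoutFn_mem_FP (nthF_mem_FP 2) (fanoutFn_mem_FP
    (comp_mem_FP (bktU_mem_FP W) (fanoutFn_mem_FP (nthF_mem_FP 0) (nthF_mem_FP 6)))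
    (fanoutFn_mem_FP (comp_mem_FP appF_mem_FP (fanoutFn_mem_FP (nthF_mem_FP 3) (fanoutFn_mem_FP (vmU_mem_FP W)
      (fanoutFn_mem_FP (pmU_mem_FP W) (const_mem_FP _)))))
      (fanoutFn_mem_FP (comp_mem_FP (cons_mem_FP true) (nthF_mem_FP 4)) (sndPow_mem_FP 6)))))
/-- `coinsU ∈ FP`. [folklore] -/
theorem coinsU_mem_FP : coinsU W ∈ FP :=
  comp_mem_FP takeFn_mem_FP (fanoutFn_mem_FP (comp_mem_FP (polyFn_mem_FP _) (nthF_mem_FP 0)) (nthF_mem_FP 6))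
/-- `finalHashF ∈ FP`. [folklore] -/
theorem finalHashF_mem_FP : finalHashF W γ ∈ FP :=
  comp_mem_FP hashOkFn_mem_FP (fanoutFn_mem_FP (nthF_mem_FP 5) (fanoutFn_mem_FP (comp_mem_FP (polyFn_mem_FP _) (nthF_mem_FP 0))
    (fanoutFn_mem_FP (comp_mem_FP dropFn_mem_FP (fanoutFn_mem_FP (const_mem_FP _) (nthF_mem_FP 1))) (coinsU_mem_FP W))))
/-- `replayArgF ∈ FP`. [folklore] -/
theorem replayArgF_mem_FP : replayArgF W ∈ FP :=
  fanoutFn_mem_FP (nthF_mem_FP 0) (fanoutFn_mem_FP (coinsU_mem_FP W) (fanoutFn_mem_FP (nthF_mem_FP 3) (nthF_mem_FP 4)))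
/-- `consistF ∈ FP`. [folklore] -/
theorem consistF_mem_FP (hW : W.IsPolyTime) : consistF W ∈ FP :=
  comp_mem_FP eqPairFn_mem_FP (fanoutFn_mem_FP (comp_mem_FP sndF_mem_FP (comp_mem_FP (replayFn_mem_FP W hW) (replayArgF_mem_FP W)))
    (nthF_mem_FP 3))
/-- `lastMovesF kf ∈ FP`. [folklore] -/
theorem lastMovesF_mem_FP (hW : W.IsPolyTime) : ∀ kf : ℕ, lastMovesF W kf ∈ FP
  | 0 => fanoutFn_mem_FP (comp_mem_FP appF_mem_FP (fanoutFn_mem_FP (nthF_mem_FP 4) (nthF_mem_FP 4))) (nthF_mem_FP 3)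
  | _ + 1 => fanoutFn_mem_FP (comp_mem_FP (cons_mem_FP true) (comp_mem_FP appF_mem_FP (fanoutFn_mem_FP (nthF_mem_FP 4) (nthF_mem_FP 4))))
      (comp_mem_FP appF_mem_FP (fanoutFn_mem_FP (nthF_mem_FP 3) (fanoutFn_mem_FP (comp_mem_FP (msgF_mem_FP W hW)
        (fanoutFn_mem_FP (nthF_mem_FP 0) (fanoutFn_mem_FP (nthF_mem_FP 0) (fanoutFn_mem_FP (coinsU_mem_FP W)
          (fanoutFn_mem_FP (comp_mem_FP appF_mem_FP (fanoutFn_mem_FP (nthF_mem_FP 4) (nthF_mem_FP 4))) (nthF_mem_FP 3))))))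
        (const_mem_FP _))))
/-- `acceptF ∈ FP`. [folklore] -/
theorem acceptF_mem_FP (hW : W.IsPolyTime) : acceptF W kf ∈ FP :=
  comp_mem_FP (indicatorFn_mem_FP hW.2) (fanoutFn_mem_FP (nthF_mem_FP 0) (fanoutFn_mem_FP (coinsU_mem_FP W) (lastMovesF_mem_FP W hW kf)))
/-- `finalOkF ∈ FP`. [folklore] -/
theorem finalOkF_mem_FP (hW : W.IsPolyTime) : finalOkF W γ kf ∈ FP :=
  andFn_mem_FP (finalHashF_mem_FP W γ) (andFn_mem_FP (consistF_mem_FP W hW) (acceptF_mem_FP W kf hW))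
/-- `chkF n ∈ FP`. [folklore] -/
theorem chkF_mem_FP (hW : W.IsPolyTime) : ∀ n : ℕ, chkF W γ kf n ∈ FP
  | 0 => finalOkF_mem_FP W γ kf hW
  | n + 1 => andFn_mem_FP (roundOkF_mem_FP W γ) (comp_mem_FP (chkF_mem_FP hW n) (stepF_mem_FP W))
/-- `initRecF ∈ FP`. [folklore] -/
theorem initRecF_mem_FP : initRecF W ∈ FP :=
  fanoutFn_mem_FP (nthF_mem_FP 0) (fanoutFn_mem_FP (comp_mem_FP dropFn_mem_FP (fanoutFn_mem_FP (const_mem_FP _)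
    (comp_mem_FP (polyFn_mem_FP _) (nthF_mem_FP 0))))
    (fanoutFn_mem_FP (comp_mem_FP (bktU_mem_FP W) (fanoutFn_mem_FP (nthF_mem_FP 0) (nthF_mem_FP 2)))
      (fanoutFn_mem_FP (const_mem_FP _) (fanoutFn_mem_FP (const_mem_FP _) (sndPow_mem_FP 2)))))
/-- `gsRefFn ∈ FP`. [folklore] -/
theorem gsRefFn_mem_FP (hW : W.IsPolyTime) : gsRefFn W γ kf R ∈ FP :=
  comp_mem_FP (chkF_mem_FP W γ kf hW R) (initRecF_mem_FP W)

/-- **The Goldwasser–Sipser referee is polynomial time** (for a polynomial-time simulated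
verifier). [cite: BabaiMoran1988, §2.5] [cite: AroraBarakCC2009, Thm. 8.12 (§8.2.3)] -/
theorem gsRef_mem_P (hW : W.IsPolyTime) : gsRef W γ kf R ∈ Classes.P :=
  preimage_mem_P UnLe_mem_P (fanoutFn_mem_FP (const_mem_FP _) (gsRefFn_mem_FP W γ kf R hW))

/-! ### One-bit tests and their values on records -/

/-- `roundOkF` is one bit. [folklore] -/
theorem oneBit_roundOkF : OneBit (roundOkF W γ) := oneBit_hashOkFn.comp _
/-- `finalHashF` is one bit. [folklore] -/
theorem oneBit_finalHashF : OneBit (finalHashF W γ) := oneBit_hashOkFn.comp _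
/-- `consistF` is one bit. [folklore] -/
theorem oneBit_consistF : OneBit (consistF W) := oneBit_eqPairFn.comp _
/-- `acceptF` is one bit. [folklore] -/
theorem oneBit_acceptF : OneBit (acceptF W kf) := fun _ => ⟨_, rfl⟩
/-- `finalOkF` is one bit. [folklore] -/
theorem oneBit_finalOkF : OneBit (finalOkF W γ kf) :=
  oneBit_andFn (oneBit_finalHashF W γ) (oneBit_andFn (oneBit_consistF W) (oneBit_acceptF W kf))
/-- `chkF n` is one bit. [folklore] -/
theorem oneBit_chkF : ∀ n : ℕ, OneBit (chkF W γ kf n)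
  | 0 => oneBit_finalOkF W γ kf
  | n + 1 => oneBit_andFn (oneBit_roundOkF W γ) ((oneBit_chkF n).comp _)

/-- **Membership in the referee language is passing the test.** [folklore] -/
theorem mem_gsRef_iff (v : List Bool) : v ∈ gsRef W γ kf R ↔ gsRefFn W γ kf R v = [true] := by
  obtain ⟨b, hb⟩ := (oneBit_chkF W γ kf R).comp (initRecF W) v
  show fanoutFn (fun _ => [true]) (gsRefFn W γ kf R) v ∈ UnLe ↔ _
  rw [fanoutFn_apply, boolPair_mem_UnLe, gsRefFn, hb]
  cases b <;> simp

/-- **The checks, unrolled by one round.** [folklore] -/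
theorem chkF_succ_eq_true_iff (n : ℕ) (z : List Bool) :
    chkF W γ kf (n + 1) z = [true] ↔ roundOkF W γ z = [true] ∧ chkF W γ kf n (stepF W z) = [true] := by
  rw [chkF]; exact andFn_eq_true_iff (oneBit_roundOkF W γ) ((oneBit_chkF W γ kf n).comp _) z

/-- **The final test, unrolled.** [folklore] -/
theorem finalOkF_eq_true_iff (z : List Bool) : finalOkF W γ kf z = [true] ↔
    finalHashF W γ z = [true] ∧ consistF W z = [true] ∧ acceptF W kf z = [true] := by
  rw [finalOkF, andFn_eq_true_iff (oneBit_finalHashF W γ) (oneBit_andFn (oneBit_consistF W) (oneBit_acceptF W kf)),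
    andFn_eq_true_iff (oneBit_consistF W) (oneBit_acceptF W kf)]

variable (x : List Bool)

/-- **Value of the round step.** [folklore] -/
theorem stepF_apply (K J E U u w rest : List Bool) :
    stepF W (rec6 x K J E U (boolPair u (boolPair w rest))) =
      rec6 x J (bktU W (boolPair x w)) (E ++ boolPair (w.take (W.msgLen.eval x.length))
        (boolPair ((w.drop (W.msgLen.eval x.length)).take (W.msgLen.eval x.length)) [])) (true :: U) rest := by
  simp [stepF, vmU, pmU, rec6, nthF, sndPow, ones]

/-- **Value of the round hash check.** [cite: AroraBarakCC2009, §8.2.2] -/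
theorem roundOkF_eq_true_iff (κ j : ℕ) (E U u w rest : List Bool) :
    roundOkF W γ (rec6 x (ones κ) (ones j) E U (boolPair u (boolPair w rest))) = [true] ↔
      HashesToZero u (W.msgLen.eval x.length) ((κ - (j + 1 + (W.coins.eval x.length + 1).size)) - γ)
        (w.take (W.msgLen.eval x.length)) := by
  obtain ⟨h0, h1, h2, h3, h4, h5, h6, h7⟩ := rec6_proj x (ones κ) (ones j) E U u w rest
  have hb : bLenU W γ (rec6 x (ones κ) (ones j) E U (boolPair u (boolPair w rest))) =
      ones ((κ - (j + 1 + (W.coins.eval x.length + 1).size)) - γ) := by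
    simp only [bLenU, Function.comp_apply, fanoutFn_apply, h0, h1, h2, betaU_apply, appF_boolPair, dropFn_boolPair]
    rw [show true :: (ones j ++ ones (W.coins.eval x.length + 1).size) = ones (j + 1 + (W.coins.eval x.length + 1).size) by
      rw [show j + 1 + (W.coins.eval x.length + 1).size = (j + (W.coins.eval x.length + 1).size) + 1 by omega]
      simp only [ones, List.replicate_succ, List.replicate_append_replicate]]
    rw [show (ones (j + 1 + (W.coins.eval x.length + 1).size)).length = j + 1 + (W.coins.eval x.length + 1).size by simp [ones],
      Com.drop_ones, show (ones γ).length = γ by simp [ones], Com.drop_ones]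
  have hv : vmU W (rec6 x (ones κ) (ones j) E U (boolPair u (boolPair w rest))) = w.take (W.msgLen.eval x.length) := by
    simp only [vmU, Function.comp_apply, fanoutFn_apply, h0, h6, emU_apply, takeFn_boolPair]; simp [ones]
  simp only [roundOkF, Function.comp_apply, fanoutFn_apply, h0, h5, hb, hv, emU_apply]
  exact hashOkFn_eq_true_iff _ _ _ _

/-- **Value of the final hash check.** [cite: AroraBarakCC2009, §8.2.2] -/
theorem finalHashF_eq_true_iff (κ : ℕ) (J E U u w rest : List Bool) :
    finalHashF W γ (rec6 x (ones κ) J E U (boolPair u (boolPair w rest))) = [true] ↔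
      HashesToZero u (W.coins.eval x.length) (κ - γ) (w.take (W.coins.eval x.length)) := by
  obtain ⟨h0, h1, h2, h3, h4, h5, h6, h7⟩ := rec6_proj x (ones κ) J E U u w rest
  have hc : coinsU W (rec6 x (ones κ) J E U (boolPair u (boolPair w rest))) = w.take (W.coins.eval x.length) := by
    simp only [coinsU, Function.comp_apply, fanoutFn_apply, h0, h6, ellU_apply, takeFn_boolPair]; simp [ones]
  simp only [finalHashF, Function.comp_apply, fanoutFn_apply, h0, h1, h5, hc, ellU_apply, dropFn_boolPair,
    show (ones γ).length = γ by simp [ones], Com.drop_ones]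
  exact hashOkFn_eq_true_iff _ _ _ _

/-- **Value of the consistency check** (with `i ≥ 1` recorded rounds). [cite: AroraBarakCC2009, §8.2.3] -/
theorem consistF_eq_true_iff (K J : List Bool) (τ : List (List Bool)) {i : ℕ} (hi : 0 < i) (hiτ : i ≤ (encList τ).length)
    (u w rest : List Bool) :
    consistF W (rec6 x K J (encList τ) (ones i) (boolPair u (boolPair w rest))) = [true] ↔
      replayModel W x (w.take (W.coins.eval x.length)) (W.msgLen.eval x.length) τ i = τ := by
  obtain ⟨h0, h1, h2, h3, h4, h5, h6, h7⟩ := rec6_proj x K J (encList τ) (ones i) u w rest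
  have hc : coinsU W (rec6 x K J (encList τ) (ones i) (boolPair u (boolPair w rest))) = w.take (W.coins.eval x.length) := by
    simp only [coinsU, Function.comp_apply, fanoutFn_apply, h0, h6, ellU_apply, takeFn_boolPair]; simp [ones]
  simp only [consistF, replayArgF, Function.comp_apply, fanoutFn_apply, h0, h3, h4, hc, replayFn_apply W x _ τ hi hiτ,
    sndF_boolPair, eqPairFn_boolPair, List.singleton_inj, decide_eq_true_iff]
  exact encList_injective'.eq_iff

/-- The consistency check with no recorded round always passes. [folklore] -/
theorem consistF_eq_true_zero (K J u w rest : List Bool) :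
    consistF W (rec6 x K J (encList []) (ones 0) (boolPair u (boolPair w rest))) = [true] := by
  obtain ⟨h0, h1, h2, h3, h4, h5, h6, h7⟩ := rec6_proj x K J (encList []) (ones 0) u w rest
  simp only [consistF, replayArgF, Function.comp_apply, fanoutFn_apply, h0, h3, h4, replayFn_apply_zero, sndF_nil,
    eqPairFn_boolPair]
  simp

/-- **Value of the acceptance check**: `W` accepts the completed transcript (its own last message
appended when `kf = 1`). [cite: AroraBarakCC2009, Def. 8.6] -/
theorem acceptF_eq_true_iff (hkf : kf ≤ 1) (K J : List Bool) (τ : List (List Bool)) (i : ℕ) (hτ : τ.length = 2 * i)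
    (u w rest : List Bool) :
    acceptF W kf (rec6 x K J (encList τ) (ones i) (boolPair u (boolPair w rest))) = [true] ↔
      IPVerifier.view x (w.take (W.coins.eval x.length))
        (if kf = 0 then τ else τ ++ [W.vmsg x (W.msgLen.eval x.length) (w.take (W.coins.eval x.length)) τ]) ∈ W.verdict := by
  obtain ⟨h0, h1, h2, h3, h4, h5, h6, h7⟩ := rec6_proj x K J (encList τ) (ones i) u w rest
  set r := w.take (W.coins.eval x.length) with hr
  have hc : coinsU W (rec6 x K J (encList τ) (ones i) (boolPair u (boolPair w rest))) = r := by
    simp only [coinsU, Function.comp_apply, fanoutFn_apply, h0, h6, ellU_apply, takeFn_boolPair]; simp [ones, hr]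
  have hUU : ones i ++ ones i = ones τ.length := by rw [hτ]; simp [ones, Nat.two_mul]
  have hlast : lastMovesF W kf (rec6 x K J (encList τ) (ones i) (boolPair u (boolPair w rest))) =
      encMoves (if kf = 0 then τ else τ ++ [W.vmsg x (W.msgLen.eval x.length) r τ]) := by
    rcases Nat.le_one_iff_eq_zero_or_eq_one.1 hkf with rfl | rfl
    · simp only [lastMovesF, Function.comp_apply, fanoutFn_apply, h3, h4, appF_boolPair, hUU]
      rw [if_pos trivial, Boards.encMoves_eq]
    · have hview : boolPair x (boolPair r (boolPair (ones τ.length) (encList τ))) = IPVerifier.view x r τ := by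
        rw [IPVerifier.view, ← Boards.encMoves_eq]
      simp only [lastMovesF, Function.comp_apply, fanoutFn_apply, h0, h3, h4, hc, appF_boolPair, hUU, hview, msgF_apply]
      rw [if_neg Nat.one_ne_zero, Boards.encMoves_eq, Boards.encList_append, List.length_append, List.length_singleton]
      simp [ones, List.replicate_succ, encList_cons]
  rw [acceptF, Function.comp_apply, fanoutFn_apply, fanoutFn_apply, h0, hc, hlast, IPVerifier.view]
  rw [show (encodeBool (W.verdict.boolIndicator _) = [true]) ↔ W.verdict.boolIndicator
      (boolPair x (boolPair r (encMoves (if kf = 0 then τ else τ ++ [W.vmsg x (W.msgLen.eval x.length) r τ])))) = true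
    by simp [encodeBool]]
  exact (Set.mem_iff_boolIndicator _ _).symm

/-- **Value of the initial record** on a referee input `⟨x, enc (w₀ :: rest)⟩`. [folklore] -/
theorem initRecF_apply (w₀ : List Bool) (rest : List (List Bool)) :
    initRecF W (boolPair x (encMoves (w₀ :: rest))) =
      rec6 x (ones (W.coins.eval x.length - 1)) (bktU W (boolPair x w₀)) [] [] (encList rest) := by
  rw [Boards.encMoves_eq, encList_cons]
  simp only [initRecF, Function.comp_apply, fanoutFn_apply, rec6]
  simp [nthF, sndPow]

end GSRef

end Literature.Computability.Complexity

end
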